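import Mathlib
import Summits.CriticalPhenomena.CardyFormulaZ2.Theorems.CardyMagicRigidityNestingRigidityUVFarBiteMultiScale
import Summits.CriticalPhenomena.CardyFormulaZ2.Theorems.CardyMagicRigidityNestingRigidityUVFarBiteSq
import Summits.CriticalPhenomena.CardyFormulaZ2.Theorems.CardyMagicRigidityNestingRigidityBigLoopsExpMomentMeetBall
import Summits.CriticalPhenomena.CardyFormulaZ2.Theorems.CardyMagicRigidityNestingRigidityUVExpMomentsChargeFree
import HarnessLib

/-!
# Crux `NestingRigidity`, line `positive-cone-weight-doubling`: Ξ — all-order CENTRED exponential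
# moments of the far UV bite statistic of the cone cloud, both lattices

Crux `Summit.CriticalPhenomena.CardyFormulaZ2.Theses.CardyMagicRigidity.NestingRigidity`
(stmt-CriticalPhenomena-4835), line `positive-cone-weight-doubling`, registered helper Ξ
`uvFarBite_expMoment_latticeEnsembles` (input (Ξ) of [A] via `uvExpMoments_of_chargeFree_bounds`):
for `E ∈ latticeEnsembles` and EVERY real order `a` there are `C, r₀ > 0` with
`E_δ exp(a (Ξ_F − E_δ Ξ_F)) ≤ C` for all `r ∈ (0, r₀)` and all small meshes, where
`Ξ_F = Σ_{u ∈ X_δ far} (φ_u − ψ_u)` is the sum of the bites (disc fraction minus ring fraction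
inside the loop) over the FAR loops (trace off the collar `A* = B̄(0, 1+2δ) ∖ B(0, r−2δ)`).

Proof (no cited fact, no definition).  A far loop is inner (trace in `B(0, r−2δ)`) or outer (trace
off `B̄(0, 1+2δ)`), and only loops meeting `B̄(0, 2)` bite (`UVFarBiteSq.finsum_far_split`), so
`Ξ_F = S₁ + S₂ + S₃` with `S₁` the inner sum (`|bite| ≤ diam²/r²`), `S₂` the sum over the outer loops
inside `B(0, 3)` (`|bite| ≤ diam²`: a loop winding around `0` from outside `B̄(0, 1)` has diameter
`> 1`) and `S₃` the sum over the outer loops leaving `B(0, 3)` — at most the NUMBER of loops meeting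
`B̄(0, 2)` of diameter `≥ 1`, whose exponential moments of all orders are keystone K6 in the
"meeting" form `expMoment_ncard_bigLoops_meeting_le_ball`.  The centred exponential moments of `S₁`
and `S₂` of all orders are the multi-scale brick `expMoment_centred_finsum_inner_le_latticeEnsembles`
(…UVFarBiteMultiScale; K6 at all centres and scales `expMoment_ncard_bigLoops_le_ball_scale`,
microscopic count `exists_ncard_loops_subset_ball_le`), with `|a| κ ρ²` bounded uniformly in `r`
(`κ = 1/r²`, `ρ = r` for `S₁`; `κ = 1`, `ρ = 3` for `S₂`); two Cauchy–Schwarz steps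
(`UVExpMoments.integral_exp_add_le`) assemble the three pieces.  `r₀ = 1`, meshes `δ ≤ r`.
-/

noncomputable section

open MeasureTheory ProbabilityTheory Set Filter Metric
open scoped Real Topology BigOperators

namespace Summit.CriticalPhenomena.CardyFormulaZ2.Cruxes.NestingRigidity.PositiveConeWeightDoubling

open Literature.Probability.RandomPlanarGeometry Literature.Probability.Percolation
  Literature.Probability.LatticeModels
open Summit.CriticalPhenomena.CardyFormulaZ2.Cruxes.NestingRigidity.RingCloudTomography

/-- The bite `φ_u − ψ_u` of a loop at disc radius `r` (local notation, not a definition). -/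
local notation3 "bite[" r ", " u "]" => (∫ z in {z | UnbasedLoop.wind u z ≠ 0}, discDensity 0 r z) -
  ∫ z in {z | UnbasedLoop.wind u z ≠ 0}, annulusDensity 0 1 2 z

namespace UVFarBite

/-! ## §1 Per-loop bounds: inner loops bite `≤ diam²/r²`, outer loops bite `≤ diam²` -/

/-- **Inner loops**: a loop inside `B(0, 1)` does not bite the ring and bites at most `diam²/r²` of
the disc `B(0, r)`. -/
theorem abs_bite_le_of_inner {u : UnbasedLoop ℂ} {r : ℝ} (hr : 0 < r) (hu : u.range ⊆ ball (0 : ℂ) 1) :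
    |bite[r, u]| ≤ 1 / r ^ 2 * diam u.range ^ 2 := by
  obtain ⟨x, hx⟩ := u.range_nonempty
  rw [ConeTilt.setIntegral_annulusDensity_eq_zero_of_range_subset hu le_rfl 2, sub_zero,
    abs_of_nonneg (ConeTilt.setIntegral_discDensity_mem_Icc 0 hr {z | u.wind z ≠ 0}).1,
    one_div_mul_eq_div]
  exact TiltTransfer.discFrac_le_diam_sq_div u hr hx

/-- **Outer loops**: a loop off `B̄(0, 1 + 2δ)` (`0 < r ≤ 1`, `0 ≤ δ`) bites at most `diam²`
(`UVFarBiteSq.biteSq_le_min_of_outer`: if it winds around `0` its diameter exceeds `1`, otherwise it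
bites only the ring, at most `diam²/3`). -/
theorem abs_bite_le_of_outer {u : UnbasedLoop ℂ} {r δ : ℝ} (hr : 0 < r) (hr1 : r ≤ 1) (hδ : 0 ≤ δ)
    (hu : u.range ⊆ (closedBall (0 : ℂ) (1 + 2 * δ))ᶜ) : |bite[r, u]| ≤ 1 * diam u.range ^ 2 := by
  have h := UVFarBiteSq.biteSq_le_min_of_outer hr (by linarith) (by linarith) hu
  rw [one_mul]
  refine abs_le_of_sq_le_sq (h.trans ((min_le_right _ _).trans (le_of_eq ?_))) (by positivity)
  ring

/-- A loop meeting `B̄(0, 2)` and leaving `B(0, 3)` has diameter `≥ 1`. -/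
theorem one_le_diam_of_meets_of_not_subset {u : UnbasedLoop ℂ}
    (hm : (u.range ∩ closedBall (0 : ℂ) 2).Nonempty) (hn : ¬ u.range ⊆ ball (0 : ℂ) 3) :
    1 ≤ diam u.range := by
  obtain ⟨p, hp, hp2⟩ := hm
  obtain ⟨q, hq, hq3⟩ := Set.not_subset.1 hn
  rw [mem_closedBall, dist_zero_right] at hp2
  rw [mem_ball, dist_zero_right, not_lt] at hq3
  have h := dist_le_diam_of_mem u.isCompact_range.isBounded hq hp
  rw [dist_eq_norm] at h
  linarith [norm_sub_norm_le q p]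

/-! ## §2 The far sum: inner part, outer part inside `B(0, 3)`, outer remainder -/

/-- **Three-way split of the far bite sum** on both lattice ensembles (mesh `δ > 0`, `0 < r ≤ 1`):
`Ξ_F = S₁ + S₂ + S₃` — inner loops (trace in `B(0, r − 2δ)`), outer loops inside `B(0, 3)` (trace in
`B(0,3) ∖ B̄(0, 1+2δ)`), and outer loops meeting `B̄(0, 2)` but leaving `B(0, 3)` (honest finite
sums: only loops meeting `B̄(0, 2)` bite). -/
theorem finsum_far_eq_three : ∀ E ∈ latticeEnsembles, ∀ {δ : ℝ}, 0 < δ → ∀ (ω : E.Ω) {r : ℝ}, 0 < r →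
    r ≤ 1 →
    ∑ᶠ u ∈ {u ∈ (E.X δ ω).loops | Disjoint u.range (closedBall (0 : ℂ) (1 + 2 * δ) \ ball 0 (r - 2 * δ))},
        bite[r, u] =
      (∑ᶠ u ∈ {u ∈ (E.X δ ω).loops | u.range ⊆ ball (0 : ℂ) (r - 2 * δ)}, bite[r, u]) +
      (∑ᶠ u ∈ {u ∈ (E.X δ ω).loops | u.range ⊆ (closedBall (0 : ℂ) (1 + 2 * δ))ᶜ ∩ ball (0 : ℂ) 3},
        bite[r, u]) +
      ∑ᶠ u ∈ {u ∈ (E.X δ ω).loops | (u.range ⊆ (closedBall (0 : ℂ) (1 + 2 * δ))ᶜ ∧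
        (u.range ∩ closedBall (0 : ℂ) 2).Nonempty) ∧ ¬ u.range ⊆ ball (0 : ℂ) 3}, bite[r, u] := by
  intro E hE δ hδ ω r hr hr1
  have hfin := ConeTilt.finite_loops_meeting E hE hδ ω 2
  have hmeet : ∀ u : UnbasedLoop ℂ, bite[r, u] ≠ 0 → (u.range ∩ closedBall (0 : ℂ) 2).Nonempty :=
    fun u hu ↦ UVFarBiteSq.meets_of_bite_ne_zero hr hr1 hu
  rw [UVFarBiteSq.finsum_far_split _ (fun u ↦ bite[r, u]) (by linarith) hfin hmeet, add_assoc]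
  congr 1
  -- split the contributing outer loops by `B(0, 3)`
  set O := {u ∈ (E.X δ ω).loops | u.range ⊆ (closedBall (0 : ℂ) (1 + 2 * δ))ᶜ ∧
    (u.range ∩ closedBall (0 : ℂ) 2).Nonempty} with hO
  have hOfin : O.Finite := hfin.subset fun u hu ↦ ⟨hu.1, hu.2.2⟩
  have hOeq : O = {u ∈ O | u.range ⊆ ball (0 : ℂ) 3} ∪ {u ∈ O | ¬ u.range ⊆ ball (0 : ℂ) 3} := by
    ext u; simp only [mem_union, mem_setOf_eq]; tauto
  have hdisj : Disjoint {u ∈ O | u.range ⊆ ball (0 : ℂ) 3} {u ∈ O | ¬ u.range ⊆ ball (0 : ℂ) 3} :=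
    Set.disjoint_left.2 fun u hu hu' ↦ hu'.2 hu.2
  have h3 : {u ∈ (E.X δ ω).loops | (u.range ⊆ (closedBall (0 : ℂ) (1 + 2 * δ))ᶜ ∧
      (u.range ∩ closedBall (0 : ℂ) 2).Nonempty) ∧ ¬ u.range ⊆ ball (0 : ℂ) 3} =
      {u ∈ O | ¬ u.range ⊆ ball (0 : ℂ) 3} := by
    ext u; simp only [hO, mem_setOf_eq, and_assoc]
  rw [h3]
  calc ∑ᶠ u ∈ O, bite[r, u]
      = ∑ᶠ u ∈ {u ∈ O | u.range ⊆ ball (0 : ℂ) 3} ∪ {u ∈ O | ¬ u.range ⊆ ball (0 : ℂ) 3}, bite[r, u] :=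
        finsum_mem_congr hOeq fun _ _ ↦ rfl
    _ = (∑ᶠ u ∈ {u ∈ O | u.range ⊆ ball (0 : ℂ) 3}, bite[r, u]) +
          ∑ᶠ u ∈ {u ∈ O | ¬ u.range ⊆ ball (0 : ℂ) 3}, bite[r, u] :=
        finsum_mem_union hdisj (hOfin.subset fun u hu ↦ hu.1) (hOfin.subset fun u hu ↦ hu.1)
    _ = _ := by
        congr 1
        refine finsum_mem_inter_support_eq' _ _ _ fun u hu ↦ ⟨fun h ↦ ⟨h.1.1, ?_⟩, fun h ↦ ?_⟩
        · exact Set.subset_inter h.1.2.1 h.2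
        · obtain ⟨hL, hsub⟩ := h
          rw [Set.subset_inter_iff] at hsub
          exact ⟨⟨hL, hsub.1, hmeet u hu⟩, hsub.2⟩

/-- **The outer remainder is dominated by a big-loop count**: `|S₃| ≤ #{u ∈ X_δ : trace meets
B̄(0, 2), diam ≥ 1}` (every loop of `S₃` is such a loop, and `|bite| ≤ 1`). -/
theorem abs_outerRest_le_ncard : ∀ E ∈ latticeEnsembles, ∀ {δ : ℝ}, 0 < δ → ∀ (ω : E.Ω) {r : ℝ}, 0 < r →
    |∑ᶠ u ∈ {u ∈ (E.X δ ω).loops | (u.range ⊆ (closedBall (0 : ℂ) (1 + 2 * δ))ᶜ ∧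
        (u.range ∩ closedBall (0 : ℂ) 2).Nonempty) ∧ ¬ u.range ⊆ ball (0 : ℂ) 3}, bite[r, u]| ≤
      ({u ∈ (E.X δ ω).loops | (u.range ∩ Metric.closedBall (0 : ℂ) (1 * 2)).Nonempty ∧
        1 * 1 ≤ Metric.diam u.range}.ncard : ℝ) := by
  intro E hE δ hδ ω r hr
  have hfin : {u ∈ (E.X δ ω).loops | (u.range ∩ Metric.closedBall (0 : ℂ) (1 * 2)).Nonempty ∧
      1 * 1 ≤ Metric.diam u.range}.Finite :=
    (ConeTilt.finite_loops_meeting E hE hδ ω 2).subset fun u hu ↦ ⟨hu.1, by simpa using hu.2.1⟩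
  refine le_trans (FirstMoment.abs_finsum_mem_le hfin (fun u hu ↦ ?_) zero_le_one
    fun u ↦ UVExpMoments.abs_bite_le_one hr u) (le_of_eq (one_mul _))
  refine ⟨hu.1.1, ?_, ?_⟩
  · rw [one_mul]; exact hu.1.2.1.2
  · rw [one_mul]; exact one_le_diam_of_meets_of_not_subset hu.1.2.1.2 hu.1.2.2

/-! ## §3 Exponential moments of the three pieces -/

/-- **The centred outer remainder has all exponential moments**: if the count
`N = #{u ∈ X_δ : trace meets B̄(0, 2), diam ≥ 1}` has `E e^{sN} ≤ C` with `|b| + 1 ≤ s`, then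
`E exp(b (S₃ − E S₃)) ≤ e^{|b| C} C` (`|S₃| ≤ N`, `|E S₃| ≤ E N ≤ E e^{sN}`). -/
theorem expMoment_outerRest_le : ∀ E ∈ latticeEnsembles, ∀ {δ : ℝ}, 0 < δ → ∀ {r : ℝ}, 0 < r →
    ∀ (b s C : ℝ), |b| + 1 ≤ s →
    Integrable (fun ω ↦ Real.exp (s * ({u ∈ (E.X δ ω).loops |
      (u.range ∩ Metric.closedBall (0 : ℂ) (1 * 2)).Nonempty ∧ 1 * 1 ≤ Metric.diam u.range}.ncard : ℝ))) E.P →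
    ∫ ω, Real.exp (s * ({u ∈ (E.X δ ω).loops |
      (u.range ∩ Metric.closedBall (0 : ℂ) (1 * 2)).Nonempty ∧ 1 * 1 ≤ Metric.diam u.range}.ncard : ℝ))
      ∂E.P ≤ C →
    Integrable (fun ω ↦ Real.exp (b * ((∑ᶠ u ∈ {u ∈ (E.X δ ω).loops |
        (u.range ⊆ (closedBall (0 : ℂ) (1 + 2 * δ))ᶜ ∧ (u.range ∩ closedBall (0 : ℂ) 2).Nonempty) ∧
          ¬ u.range ⊆ ball (0 : ℂ) 3}, bite[r, u]) -
      ∫ ω', (∑ᶠ u ∈ {u ∈ (E.X δ ω').loops |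
        (u.range ⊆ (closedBall (0 : ℂ) (1 + 2 * δ))ᶜ ∧ (u.range ∩ closedBall (0 : ℂ) 2).Nonempty) ∧
          ¬ u.range ⊆ ball (0 : ℂ) 3}, bite[r, u]) ∂E.P))) E.P ∧
    ∫ ω, Real.exp (b * ((∑ᶠ u ∈ {u ∈ (E.X δ ω).loops |
        (u.range ⊆ (closedBall (0 : ℂ) (1 + 2 * δ))ᶜ ∧ (u.range ∩ closedBall (0 : ℂ) 2).Nonempty) ∧
          ¬ u.range ⊆ ball (0 : ℂ) 3}, bite[r, u]) -
      ∫ ω', (∑ᶠ u ∈ {u ∈ (E.X δ ω').loops |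
        (u.range ⊆ (closedBall (0 : ℂ) (1 + 2 * δ))ᶜ ∧ (u.range ∩ closedBall (0 : ℂ) 2).Nonempty) ∧
          ¬ u.range ⊆ ball (0 : ℂ) 3}, bite[r, u]) ∂E.P)) ∂E.P ≤ Real.exp (|b| * C) * C := by
  intro E hE δ hδ r hr b s C hbs hNi hNC
  haveI := isProbabilityMeasure_of_mem hE
  set S : E.Ω → ℝ := fun ω ↦ ∑ᶠ u ∈ {u ∈ (E.X δ ω).loops |
    (u.range ⊆ (closedBall (0 : ℂ) (1 + 2 * δ))ᶜ ∧ (u.range ∩ closedBall (0 : ℂ) 2).Nonempty) ∧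
      ¬ u.range ⊆ ball (0 : ℂ) 3}, bite[r, u] with hS
  set N : E.Ω → ℝ := fun ω ↦ ({u ∈ (E.X δ ω).loops |
    (u.range ∩ Metric.closedBall (0 : ℂ) (1 * 2)).Nonempty ∧ 1 * 1 ≤ Metric.diam u.range}.ncard : ℝ)
    with hN
  have hSm : Measurable S := FirstMoment.measurable_finsum_loops_sep E hE δ _ _
  have hNm : Measurable N := measurable_from_nat.comp (BigLoops.measurable_ncard_loops_sep E hE δ _)
  have hSN : ∀ ω, |S ω| ≤ N ω := fun ω ↦ abs_outerRest_le_ncard E hE hδ ω hr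
  have hN0 : ∀ ω, 0 ≤ N ω := fun ω ↦ Nat.cast_nonneg _
  have hs1 : 1 ≤ s := le_trans (by linarith [abs_nonneg b]) hbs
  -- `N ≤ e^{sN}`: integrability of `N` and `E N ≤ C`
  have hNexp : ∀ ω, N ω ≤ Real.exp (s * N ω) := fun ω ↦
    (by nlinarith [hN0 ω] : N ω ≤ s * N ω).trans (by linarith [Real.add_one_le_exp (s * N ω)])
  have hNint : Integrable N E.P := hNi.mono' hNm.aestronglyMeasurable
    (Eventually.of_forall fun ω ↦ by rw [Real.norm_eq_abs, abs_of_nonneg (hN0 ω)]; exact hNexp ω)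
  have hEN : ∫ ω, N ω ∂E.P ≤ C := (integral_mono hNint hNi hNexp).trans hNC
  have hSint : Integrable S E.P := hNint.mono' hSm.aestronglyMeasurable
    (Eventually.of_forall fun ω ↦ by rw [Real.norm_eq_abs]; exact hSN ω)
  have hES : |∫ ω, S ω ∂E.P| ≤ C := by
    calc |∫ ω, S ω ∂E.P| ≤ ∫ ω, |S ω| ∂E.P := abs_integral_le_integral_abs
      _ ≤ ∫ ω, N ω ∂E.P := integral_mono hSint.abs hNint hSN
      _ ≤ C := hEN
  -- pointwise: `exp(b (S − E S)) ≤ e^{|b| C} e^{s N}`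
  have hpt : ∀ ω, Real.exp (b * (S ω - ∫ ω', S ω' ∂E.P)) ≤ Real.exp (|b| * C) * Real.exp (s * N ω) := by
    intro ω
    rw [← Real.exp_add]
    refine Real.exp_le_exp.2 ?_
    have h1 : b * (S ω - ∫ ω', S ω' ∂E.P) ≤ |b| * |S ω| + |b| * |∫ ω', S ω' ∂E.P| := by
      calc b * (S ω - ∫ ω', S ω' ∂E.P) ≤ |b * (S ω - ∫ ω', S ω' ∂E.P)| := le_abs_self _
        _ = |b| * |S ω - ∫ ω', S ω' ∂E.P| := abs_mul _ _
        _ ≤ |b| * (|S ω| + |∫ ω', S ω' ∂E.P|) :=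
          mul_le_mul_of_nonneg_left (abs_sub _ _) (abs_nonneg b)
        _ = |b| * |S ω| + |b| * |∫ ω', S ω' ∂E.P| := mul_add _ _ _
    have h2 : |b| * |S ω| ≤ s * N ω := by
      calc |b| * |S ω| ≤ |b| * N ω := mul_le_mul_of_nonneg_left (hSN ω) (abs_nonneg b)
        _ ≤ s * N ω := mul_le_mul_of_nonneg_right (by linarith) (hN0 ω)
    have h3 : |b| * |∫ ω', S ω' ∂E.P| ≤ |b| * C := mul_le_mul_of_nonneg_left hES (abs_nonneg b)
    linarith
  have hmeas : Measurable fun ω ↦ Real.exp (b * (S ω - ∫ ω', S ω' ∂E.P)) :=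
    Real.measurable_exp.comp ((hSm.sub_const _).const_mul b)
  have hint : Integrable (fun ω ↦ Real.exp (b * (S ω - ∫ ω', S ω' ∂E.P))) E.P :=
    (hNi.const_mul (Real.exp (|b| * C))).mono' hmeas.aestronglyMeasurable
      (Eventually.of_forall fun ω ↦ by
        rw [Real.norm_eq_abs, abs_of_pos (Real.exp_pos _)]; exact hpt ω)
  refine ⟨hint, ?_⟩
  calc ∫ ω, Real.exp (b * (S ω - ∫ ω', S ω' ∂E.P)) ∂E.P
      ≤ ∫ ω, Real.exp (|b| * C) * Real.exp (s * N ω) ∂E.P := integral_mono hint (hNi.const_mul _) hpt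
    _ = Real.exp (|b| * C) * ∫ ω, Real.exp (s * N ω) ∂E.P := integral_const_mul _ _
    _ ≤ Real.exp (|b| * C) * C := mul_le_mul_of_nonneg_left hNC (Real.exp_pos _).le

end UVFarBite

open UVFarBite in
/-- **Ξ · all-order CENTRED exponential moments of the far UV bite statistic, both lattices**
(registered helper toward [A] `uvExpMoments_latticeEnsembles` / R1' `stub_uvDecoupling`, line
`positive-cone-weight-doubling`).  For `E ∈ latticeEnsembles` and every real `a` there are `C` and
`r₀ > 0` (`r₀ = 1`) such that for every `r ∈ (0, r₀)` and all small meshes (`δ ≤ r`),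
`E_δ exp(a (Ξ_F − E_δ Ξ_F)) ≤ C`, where `Ξ_F = Σ_{u ∈ X_δ, trace u ∩ A* = ∅} (φ_u − ψ_u)`
(`A* = B̄(0, 1 + 2δ) ∖ B(0, r − 2δ)`; `φ_u`, `ψ_u` the fractions of the disc `B(0, r)` and of the ring
`{1 ≤ |z| < 2}` inside `int u`).  Both tails, all orders, uniformly in `r`: the multi-scale brick for
the inner loops (`κ = 1/r²`, `ρ = r`) and for the outer loops inside `B(0, 3)` (`κ = 1`, `ρ = 3`),
K6 in meeting form for the outer loops leaving `B(0, 3)`, two Cauchy–Schwarz steps. -/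
theorem uvFarBite_expMoment_latticeEnsembles : ∀ E ∈ latticeEnsembles, ∀ a : ℝ, ∃ C r₀ : ℝ, 0 < r₀ ∧ ∀ r ∈ Set.Ioo (0 : ℝ) r₀, ∀ᶠ δ in 𝓝[>] (0 : ℝ), ∫ ω, Real.exp (a * ((∑ᶠ u ∈ {u ∈ (E.X δ ω).loops | Disjoint u.range (Metric.closedBall (0 : ℂ) (1 + 2 * δ) \ Metric.ball 0 (r - 2 * δ))}, ((∫ z in {z | u.wind z ≠ 0}, discDensity 0 r z) - ∫ z in {z | u.wind z ≠ 0}, annulusDensity 0 1 2 z)) - ∫ ω', (∑ᶠ u ∈ {u ∈ (E.X δ ω').loops | Disjoint u.range (Metric.closedBall (0 : ℂ) (1 + 2 * δ) \ Metric.ball 0 (r - 2 * δ))}, ((∫ z in {z | u.wind z ≠ 0}, discDensity 0 r z) - ∫ z in {z | u.wind z ≠ 0}, annulusDensity 0 1 2 z)) ∂E.P)) ∂E.P ≤ C := by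
  intro E hE a
  haveI := isProbabilityMeasure_of_mem hE
  -- the multi-scale brick at order `4a` with `|a'| κ ρ² ≤ 36 |a|`: `A = 1152 · 36 |a|`
  set A : ℝ := 41472 * |a| with hA
  obtain ⟨K, c₁, -, hc₁, hK6⟩ := expMoment_ncard_bigLoops_le_ball_scale E hE (A + 1) 6 1 one_pos (by norm_num)
  set c₀ : ℝ := max c₁ 1 with hc₀
  have hK6' : ∀ (x : ℂ) (l δ : ℝ), 0 < l → 0 < δ → c₀ * δ ≤ l * 1 →
      Integrable (fun ω ↦ Real.exp ((A + 1) * ({u ∈ (E.X δ ω).loops |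
        u.range ⊆ Metric.ball x (l * 6) ∧ l * 1 ≤ Metric.diam u.range}.ncard : ℝ))) E.P ∧
      ∫ ω, Real.exp ((A + 1) * ({u ∈ (E.X δ ω).loops |
        u.range ⊆ Metric.ball x (l * 6) ∧ l * 1 ≤ Metric.diam u.range}.ncard : ℝ)) ∂E.P ≤ K :=
    fun x l δ hl hδ h ↦ hK6 x l δ hl hδ ((mul_le_mul_of_nonneg_right (le_max_left _ _) hδ.le).trans h)
  obtain ⟨M, hM⟩ := exists_ncard_loops_subset_ball_le E hE (12 * c₀)
  obtain ⟨Cb, hCb⟩ := expMoment_centred_finsum_inner_le_latticeEnsembles E hE A K c₀ M (le_max_right _ _)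
    hK6' hM
  -- K6 in meeting form at order `2|a| + 1`
  obtain ⟨Cm, hCm, hmeet⟩ := expMoment_ncard_bigLoops_meeting_le_ball E hE (2 * |a| + 1) 2 1 one_pos
    (by norm_num)
  set Mx : ℝ := max Cb (Real.exp (|2 * a| * Cm) * Cm) with hMx
  refine ⟨Mx, 1, one_pos, fun r hr ↦ ?_⟩
  obtain ⟨hr0, hr1⟩ := hr
  filter_upwards [Ioc_mem_nhdsGT hr0] with δ hδ
  obtain ⟨hδ0, hδr⟩ := hδ
  -- the three pieces
  set S₁ : E.Ω → ℝ := fun ω ↦ ∑ᶠ u ∈ {u ∈ (E.X δ ω).loops | u.range ⊆ ball (0 : ℂ) (r - 2 * δ)},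
    bite[r, u] with hS₁
  set S₂ : E.Ω → ℝ := fun ω ↦ ∑ᶠ u ∈ {u ∈ (E.X δ ω).loops |
    u.range ⊆ (closedBall (0 : ℂ) (1 + 2 * δ))ᶜ ∩ ball (0 : ℂ) 3}, bite[r, u] with hS₂
  set S₃ : E.Ω → ℝ := fun ω ↦ ∑ᶠ u ∈ {u ∈ (E.X δ ω).loops |
    (u.range ⊆ (closedBall (0 : ℂ) (1 + 2 * δ))ᶜ ∧ (u.range ∩ closedBall (0 : ℂ) 2).Nonempty) ∧
      ¬ u.range ⊆ ball (0 : ℂ) 3}, bite[r, u] with hS₃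
  have hsplit : ∀ ω, (∑ᶠ u ∈ {u ∈ (E.X δ ω).loops |
      Disjoint u.range (closedBall (0 : ℂ) (1 + 2 * δ) \ ball 0 (r - 2 * δ))}, bite[r, u]) =
      S₁ ω + S₂ ω + S₃ ω := fun ω ↦ finsum_far_eq_three E hE hδ0 ω hr0 hr1.le
  -- integrability of the pieces (bounded statistics at a fixed mesh)
  have hbite1 : ∀ u : UnbasedLoop ℂ, |bite[r, u]| ≤ 1 := UVExpMoments.abs_bite_le_one hr0
  have hbite0 : ∀ u : UnbasedLoop ℂ, u.nestingPhase (coneCloud 1 r).density = 0 → bite[r, u] = 0 :=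
    fun u hu ↦ by rw [UVExpMoments.bite_eq_nestingPhase_one, hu]
  have hS₁i : Integrable S₁ E.P :=
    TiltTransfer.integrable_finsum_sep E hE hδ0 1 hr0 hr1.le
      (fun u ↦ u.range ⊆ ball (0 : ℂ) (r - 2 * δ)) (fun u ↦ bite[r, u]) zero_le_one hbite1 hbite0
  have hS₂i : Integrable S₂ E.P :=
    TiltTransfer.integrable_finsum_sep E hE hδ0 1 hr0 hr1.le
      (fun u ↦ u.range ⊆ (closedBall (0 : ℂ) (1 + 2 * δ))ᶜ ∩ ball (0 : ℂ) 3) (fun u ↦ bite[r, u])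
      zero_le_one hbite1 hbite0
  have hS₃i : Integrable S₃ E.P :=
    TiltTransfer.integrable_finsum_sep E hE hδ0 1 hr0 hr1.le
      (fun u ↦ (u.range ⊆ (closedBall (0 : ℂ) (1 + 2 * δ))ᶜ ∧ (u.range ∩ closedBall (0 : ℂ) 2).Nonempty) ∧
        ¬ u.range ⊆ ball (0 : ℂ) 3) (fun u ↦ bite[r, u]) zero_le_one hbite1 hbite0
  have hS₁m : Measurable S₁ := FirstMoment.measurable_finsum_loops_sep E hE δ
    (fun u ↦ u.range ⊆ ball (0 : ℂ) (r - 2 * δ)) (fun u ↦ bite[r, u])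
  have hS₂m : Measurable S₂ := FirstMoment.measurable_finsum_loops_sep E hE δ
    (fun u ↦ u.range ⊆ (closedBall (0 : ℂ) (1 + 2 * δ))ᶜ ∩ ball (0 : ℂ) 3) (fun u ↦ bite[r, u])
  have hS₃m : Measurable S₃ := FirstMoment.measurable_finsum_loops_sep E hE δ
    (fun u ↦ (u.range ⊆ (closedBall (0 : ℂ) (1 + 2 * δ))ᶜ ∧ (u.range ∩ closedBall (0 : ℂ) 2).Nonempty) ∧
      ¬ u.range ⊆ ball (0 : ℂ) 3) (fun u ↦ bite[r, u])
  -- the brick for the inner part: `κ = 1/r²`, `ρ = r`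
  have hB₁ := hCb 0 r (1 / r ^ 2) (4 * a) δ (ball (0 : ℂ) (r - 2 * δ)) (fun u ↦ bite[r, u]) hr0
    (by positivity) hδ0 hδr (ball_subset_ball (by linarith))
    (fun u hu ↦ abs_bite_le_of_inner hr0 (hu.trans (ball_subset_ball (by linarith))))
    (by
      rw [hA, abs_mul, abs_of_pos (by norm_num : (0 : ℝ) < 4), mul_assoc (1152 * (4 * |a|)),
        one_div_mul_cancel (by positivity : r ^ 2 ≠ 0), mul_one]
      linarith [abs_nonneg a])
  -- the brick for the outer part inside `B(0, 3)`: `κ = 1`, `ρ = 3`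
  have hB₂ := hCb 0 3 1 (4 * a) δ ((closedBall (0 : ℂ) (1 + 2 * δ))ᶜ ∩ ball (0 : ℂ) 3)
    (fun u ↦ bite[r, u]) (by norm_num) zero_le_one hδ0 (by linarith) Set.inter_subset_right
    (fun u hu ↦ abs_bite_le_of_outer hr0 hr1.le hδ0.le (hu.trans Set.inter_subset_left))
    (by
      rw [hA, abs_mul, abs_of_pos (by norm_num : (0 : ℝ) < 4)]
      have : (1152 : ℝ) * (4 * |a|) * 1 * 3 ^ 2 = 41472 * |a| := by ring
      rw [this])
  -- the outer remainder
  have hB₃ := expMoment_outerRest_le E hE hδ0 hr0 (2 * a) (2 * |a| + 1) Cm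
    (by rw [abs_mul, abs_of_pos (by norm_num : (0 : ℝ) < 2)]) (hmeet 0 1 δ one_pos hδ0).1
    (hmeet 0 1 δ one_pos hδ0).2
  -- first Cauchy–Schwarz: the two multi-scale pieces at order `2a`
  have hCbMx : Cb ≤ Mx := le_max_left _ _
  have h12 := UVExpMoments.integral_exp_add_le E hE (fun ω ↦ 2 * (a * (S₁ ω - ∫ ω', S₁ ω' ∂E.P)))
    (fun ω ↦ 2 * (a * (S₂ ω - ∫ ω', S₂ ω' ∂E.P))) (M := Mx)
    (((hS₁m.sub_const _).const_mul a).const_mul 2) (((hS₂m.sub_const _).const_mul a).const_mul 2)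
    (by simpa only [show ∀ x : ℝ, 2 * (2 * (a * x)) = 4 * a * x from fun x ↦ by ring] using hB₁.1)
    (by simpa only [show ∀ x : ℝ, 2 * (2 * (a * x)) = 4 * a * x from fun x ↦ by ring] using
      hB₁.2.trans hCbMx)
    (by simpa only [show ∀ x : ℝ, 2 * (2 * (a * x)) = 4 * a * x from fun x ↦ by ring] using hB₂.1)
    (by simpa only [show ∀ x : ℝ, 2 * (2 * (a * x)) = 4 * a * x from fun x ↦ by ring] using
      hB₂.2.trans hCbMx)
  -- second Cauchy–Schwarz: with the outer remainder at order `2a`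
  have h123 := UVExpMoments.integral_exp_add_le E hE
    (fun ω ↦ a * (S₁ ω - ∫ ω', S₁ ω' ∂E.P) + a * (S₂ ω - ∫ ω', S₂ ω' ∂E.P))
    (fun ω ↦ a * (S₃ ω - ∫ ω', S₃ ω' ∂E.P)) (M := Mx)
    (((hS₁m.sub_const _).const_mul a).add ((hS₂m.sub_const _).const_mul a))
    ((hS₃m.sub_const _).const_mul a)
    (by simpa only [mul_add] using h12.1) (by simpa only [mul_add] using h12.2)
    (by simpa only [show ∀ x : ℝ, 2 * (a * x) = 2 * a * x from fun x ↦ by ring] using hB₃.1)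
    (by simpa only [show ∀ x : ℝ, 2 * (a * x) = 2 * a * x from fun x ↦ by ring] using
      hB₃.2.trans (le_max_right _ _))
  -- identification of the integrand
  have hmean : ∫ ω', (∑ᶠ u ∈ {u ∈ (E.X δ ω').loops |
      Disjoint u.range (closedBall (0 : ℂ) (1 + 2 * δ) \ ball 0 (r - 2 * δ))}, bite[r, u]) ∂E.P =
      (∫ ω', S₁ ω' ∂E.P) + (∫ ω', S₂ ω' ∂E.P) + ∫ ω', S₃ ω' ∂E.P := by
    rw [integral_congr_ae (ae_of_all _ hsplit),
      integral_add (f := fun ω ↦ S₁ ω + S₂ ω) (hS₁i.add hS₂i) hS₃i, integral_add hS₁i hS₂i]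
  have hfun : (fun ω ↦ Real.exp (a * ((∑ᶠ u ∈ {u ∈ (E.X δ ω).loops |
      Disjoint u.range (closedBall (0 : ℂ) (1 + 2 * δ) \ ball 0 (r - 2 * δ))}, bite[r, u]) -
      ∫ ω', (∑ᶠ u ∈ {u ∈ (E.X δ ω').loops |
        Disjoint u.range (closedBall (0 : ℂ) (1 + 2 * δ) \ ball 0 (r - 2 * δ))}, bite[r, u]) ∂E.P))) =
      fun ω ↦ Real.exp ((a * (S₁ ω - ∫ ω', S₁ ω' ∂E.P) + a * (S₂ ω - ∫ ω', S₂ ω' ∂E.P)) +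
        a * (S₃ ω - ∫ ω', S₃ ω' ∂E.P)) := by
    funext ω
    rw [hsplit ω, hmean]
    congr 1
    ring
  exact (integral_congr_ae (ae_of_all E.P fun ω ↦ congrFun hfun ω)).trans_le h123.2

end Summit.CriticalPhenomena.CardyFormulaZ2.Cruxes.NestingRigidity.PositiveConeWeightDoubling

end
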